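/-
Copyright: lit-balaban cell (HOME `run/shared/lean/pub/lit-balaban/`), Phase-2 proof seat p12 (gen 7).  The proofs reproduce the
printed arguments; nothing is claimed beyond what the kernel checks below.
-/
import Literature.MathematicalPhysics.QuantumFieldTheory.DybalskiStottmeisterTanimoto2024.DST24Setting

/-!
# `DybalskiStottmeisterTanimoto2024.DST24Configurations` — [DybalskiStottmeisterTanimoto2024] **§2.2 «Sets of configurations»**
# PROVED: Lemma (chain), Lemma (positivity of `|𝒞₀|`) with the display (N-computation), Lemma (configurations)
# `‖U′(x) − 1‖ ≤ 4c_{1/2}Lε`, Lemma (A-theorem), **Theorem (configurations-theorem)**; App. B Lemma (square-root) in the form used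

statement-level skeleton of published theorems with citation tags; proofs where landed; nothing here is a claim about
the Yang–Mills mass gap

W. Dybalski, A. Stottmeister, Y. Tanimoto, *The Bałaban variational problem in the non-linear sigma model*, Rev. Math. Phys.
**36** (2024), arXiv:2403.09800; source held `paper:arxiv-2403.09800` (§2.2 = tex chunk p0007, App. B = p0023; no theorem numbers
in the tex, items cited by section + tex label).  Unit `lit-balaban-p12` (gen 7); setting, carrier and dictionary (`SU(2)` = unit
quaternions, `A⃗ = −Im q`, `‖·‖` = quaternion norm = print's operator norm) in `DST24Setting`.

WHAT IS PRINTED (§2.2) AND PROVED HERE, statement by statement (`U ∈ Conf_ε(Ω)`, `x, x′ ∈ B(y)`):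
* Lemma (chain): «`‖U(x)U(x′)* − 1‖ ≤ (2L)ε`» — `chain`; proof as printed (shortest bond path inside the box, one `ε` per bond,
  `‖∂U(b) − 1‖ = ‖∂U(b)* − 1‖`), organised as an induction on the `ℓ¹`-distance inside the box (`≤ 2(L−1) ≤ 2L` bonds), using
  `‖pq* − 1‖ = ‖p − q‖` for unit quaternions (`norm_mul_star_sub_one`).
* Lemma (`|𝒞₀(U)(y)|` strictly positive for `0 < ε ≤ 1/(4L)`) with its display
  «`𝒞₀(U)(y)*𝒞₀(U)(y) = 1 + L⁻⁴ Σ_{x≠x′∈B(y)} (U(x)*U(x′) − 1)`» — `N_computation`, `abs_normSq_C0_sub_one_le` (`≤ 2Lε`), `C0_ne_zero`.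
* App. B Lemma (square-root) «`‖(1+M)^{1/2} − 1‖ ≤ c_{1/2}‖M‖`, `‖M‖ < 1/2`, `c_{1/2} ≥ 1` a numerical constant» in the form the text
  USES it (for the modulus `(𝒞₀*𝒞₀)^{∓1/2}` of a quaternion, a real scalar): `abs_sqrt_sub_one_le`, `abs_inv_sqrt_sub_one_le`
  with `ch = c_{1/2} := π√2/(√2+1)` = the value of print's `∫₀^∞ √y/((y+1)(y+½)) dy` (`one_le_ch`).
* (2.1)/(constraint-simpl-x): with `U(x) = U′(x)V(y_x)`, «`𝒞(U) = V ⇔ 𝒞₀(U′)(y) = (𝒞₀(U′)(y)*𝒞₀(U′)(y))^{1/2}`» (where `𝒞₀ ≠ 0`, as in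
  the regime of the text) — `Uprime`, `C0_Uprime`, `constraint_iff_C0_real`.
* Lemma (configurations): «Let `0 < ε ≤ 1/(4L)` and suppose that `U ∈ Conf_ε(Ω)` satisfies the constraint. Then
  `‖U′(x) − 1‖ ≤ 4c_{1/2}Lε`» — `configurations`.
* Lemma (A-theorem): «`U′ ∈ Conf^ε(Ω) ⇒ (A⃗ ∈ Conf⃗^ε(Ω) and δ = 1)`», `0 < ε ≤ 1`, with its display
  «`‖U′ − 1‖² = 2|A⃗|²/(1 + √(1 − |A⃗|²))`» — `norm_sub_one_sq_eq`, `A_theorem`.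
* **Theorem (configurations-theorem)**: «`U ∈ Conf_ε(Ω)` and `𝒞(U) = V ⇒ U′ ∈ Conf^{4c_{1/2}Lε}(Ω)`» and
  «`U′ ∈ Conf^{4c_{1/2}Lε}(Ω) ⇒ (A⃗ ∈ Conf⃗^{4c_{1/2}Lε}(Ω) and δ = 1)`, the second requires `4c_{1/2}Lε ≤ 1`» —
  `configurations_theorem_first` (hypothesis `ε ≤ 1/(4L)`, that of the Lemma it is printed to follow from),
  `configurations_theorem_second`.
READING NOTES (not errata): print's Lemma (square-root) is displayed for `(1+M)^{1/2}` and applied to `(𝒞₀*𝒞₀)^{−1/2}`; for the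
scalar modulus of a quaternion both hold with any constant `≥ 1`.  The hypothesis `V ∈ Conf_{ε₁}(Ω₁)` of the Theorem is not used by
either implication and is therefore not a binder here.
-/

namespace Literature.MathematicalPhysics.QuantumFieldTheory.DybalskiStottmeisterTanimoto2024.DST24Configurations

open scoped Quaternion RealInnerProductSpace BigOperators
open Literature.MathematicalPhysics.QuantumFieldTheory.Federbush1986
open Literature.MathematicalPhysics.QuantumFieldTheory.DybalskiStottmeisterTanimoto2024.DST24Setting

noncomputable section

variable {L n₁ : ℕ}

/-! ## Unit-quaternion bookkeeping -/

/-- `‖pq* − 1‖ = ‖p − q‖` for `q ∈ SU(2)` (right multiplication by a unit quaternion is an isometry).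
[cite: DybalskiStottmeisterTanimoto2024, §2.2 Lemma (chain), proof] -/
theorem norm_mul_star_sub_one (p : ℍ) (q : SU2) : ‖p * star q.val - 1‖ = ‖p - q.val‖ := by
  have h : p * star q.val - 1 = (p - q.val) * star q.val := by
    rw [sub_mul, q.val_mul_star_val]
  rw [h, norm_mul, Quaternion.norm_star, q.norm_val, mul_one]

/-- `‖p*q − 1‖ = ‖q − p‖` for `p ∈ SU(2)`. [cite: DybalskiStottmeisterTanimoto2024, §2.2 Lemma (N), proof] -/
theorem norm_star_mul_sub_one (p : SU2) (q : ℍ) : ‖star p.val * q - 1‖ = ‖q - p.val‖ := by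
  have h : star p.val * q - 1 = star p.val * (q - p.val) := by
    rw [mul_sub, p.star_val_mul_val]
  rw [h, norm_mul, Quaternion.norm_star, p.norm_val, one_mul]

/-- The small-field condition bond by bond: `‖U(b₋) − U(b₊)‖ = ‖∂U(b) − 1‖ ≤ ε`. [cite: DybalskiStottmeisterTanimoto2024, §2.2 Lemma (chain), proof] -/
theorem norm_sub_le_of_bond {ε : ℝ} {U : Conf L n₁} (hU : U ∈ smallField ε) (b : Bond L n₁) :
    ‖(U b.src).val - (U b.tgt).val‖ ≤ ε := by
  rw [← norm_mul_star_sub_one]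
  exact hU b

/-! ## Lemma (chain): paths inside a box -/

/-- The `ℓ¹`-distance of two sites, `Σ_μ |x_μ − x′_μ|` (written with truncated subtraction: `(a ∸ b) + (b ∸ a) = |a − b|`).
[cite: DybalskiStottmeisterTanimoto2024, §2.2 Lemma (chain), proof («shortest oriented path of bonds»)] -/
def l1 (x x' : Site L n₁) : ℕ := ∑ μ, (((x μ : ℕ) - (x' μ : ℕ)) + ((x' μ : ℕ) - (x μ : ℕ)))

/-- [cite: DybalskiStottmeisterTanimoto2024, §2.2 Lemma (chain), proof] -/
theorem l1_eq_zero_iff (x x' : Site L n₁) : l1 x x' = 0 ↔ x = x' := by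
  unfold l1
  rw [Finset.sum_eq_zero_iff]
  constructor
  · intro h
    funext μ
    have := h μ (Finset.mem_univ μ)
    exact Fin.ext (by omega)
  · rintro rfl μ -
    simp

/-- Inside a box the `ℓ¹`-distance is `≤ 2(L−1)` («`ℓ ≤ 2L`»). [cite: DybalskiStottmeisterTanimoto2024, §2.2 Lemma (chain), proof] -/
theorem l1_le_of_mem_box (hL : 0 < L) {y : CSite n₁} {x x' : Site L n₁} (hx : x ∈ box L y) (hx' : x' ∈ box L y) :
    l1 x x' ≤ 2 * (L - 1) := by
  rw [mem_box_iff hL] at hx hx'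
  unfold l1
  have key : ∀ μ, ((x μ : ℕ) - (x' μ : ℕ)) + ((x' μ : ℕ) - (x μ : ℕ)) ≤ L - 1 := by
    intro μ
    obtain ⟨h1, h2⟩ := hx μ
    obtain ⟨h3, h4⟩ := hx' μ
    omega
  calc ∑ μ, (((x μ : ℕ) - (x' μ : ℕ)) + ((x' μ : ℕ) - (x μ : ℕ))) ≤ ∑ _μ : Fin 2, (L - 1) :=
        Finset.sum_le_sum fun μ _ => key μ
    _ = 2 * (L - 1) := by simp

/-- Moving one coordinate: the `ℓ¹`-distance changes by the change of that coordinate's contribution.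
[cite: DybalskiStottmeisterTanimoto2024, §2.2 Lemma (chain), proof] -/
theorem l1_update (x x' : Site L n₁) (μ : Fin 2) (v : Fin (L * n₁)) :
    l1 (Function.update x μ v) x' + (((x μ : ℕ) - (x' μ : ℕ)) + ((x' μ : ℕ) - (x μ : ℕ))) =
      l1 x x' + (((v : ℕ) - (x' μ : ℕ)) + ((x' μ : ℕ) - (v : ℕ))) := by
  unfold l1
  rw [← Finset.add_sum_erase _ _ (Finset.mem_univ μ), ← Finset.add_sum_erase Finset.univ _ (Finset.mem_univ μ),
    Function.update_self]
  have : ∑ ν ∈ Finset.univ.erase μ,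
      (((Function.update x μ v ν : ℕ) - (x' ν : ℕ)) + ((x' ν : ℕ) - (Function.update x μ v ν : ℕ))) =
      ∑ ν ∈ Finset.univ.erase μ, (((x ν : ℕ) - (x' ν : ℕ)) + ((x' ν : ℕ) - (x ν : ℕ))) := by
    refine Finset.sum_congr rfl fun ν hν => ?_
    rw [Function.update_of_ne (Finset.ne_of_mem_erase hν)]
  rw [this]
  ring

/-- **Lemma (chain)**, quantitative core: along bonds inside one box, `‖U(x) − U(x′)‖ ≤ ℓ¹(x,x′)·ε`.
[cite: DybalskiStottmeisterTanimoto2024, §2.2 Lemma (chain), proof] -/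
theorem norm_sub_le_l1_mul (hL : 0 < L) {ε : ℝ} {U : Conf L n₁} (hU : U ∈ smallField ε) {y : CSite n₁} :
    ∀ n : ℕ, ∀ x x' : Site L n₁, x ∈ box L y → x' ∈ box L y → l1 x x' = n →
      ‖(U x).val - (U x').val‖ ≤ n * ε := by
  intro n
  induction n with
  | zero =>
    intro x x' _ _ h0
    rw [(l1_eq_zero_iff x x').mp h0, sub_self, norm_zero, Nat.cast_zero, zero_mul]
  | succ n ih =>
    intro x x' hx hx' hn
    -- a coordinate in which `x` and `x'` differ
    have hne : x ≠ x' := by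
      intro h; rw [(l1_eq_zero_iff x x').mpr h] at hn; exact absurd hn (by omega)
    obtain ⟨μ, hμ⟩ : ∃ μ, x μ ≠ x' μ := by
      by_contra h
      exact hne (funext fun ν => by_contra fun hν => h ⟨ν, hν⟩)
    have hxμ := (mem_box_iff hL).mp hx μ
    have hx'μ := (mem_box_iff hL).mp hx' μ
    have hx'lt := (x' μ).isLt
    have hxlt := (x μ).isLt
    rcases lt_or_gt_of_ne (Fin.val_ne_of_ne hμ) with hlt | hgt
    · -- step up: `x'' = x + e_μ`, the bond `b = (x, x'')`
      let v : Fin (L * n₁) := ⟨(x μ : ℕ) + 1, by omega⟩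
      let b : Bond L n₁ := ⟨(x, μ), show (x μ : ℕ) + 1 < L * n₁ by omega⟩
      have htgt : b.tgt = Function.update x μ v := rfl
      have h'' : Function.update x μ v ∈ box L y := by
        rw [mem_box_iff hL]
        intro ν
        by_cases hν : ν = μ
        · subst hν; rw [Function.update_self]; change L * _ ≤ (x ν : ℕ) + 1 ∧ (x ν : ℕ) + 1 < _; omega
        · rw [Function.update_of_ne hν]; exact (mem_box_iff hL).mp hx ν
      have hl1 : l1 (Function.update x μ v) x' = n := by
        have e := l1_update x x' μ v
        change l1 (Function.update x μ v) x' + _ = l1 x x' + (((x μ : ℕ) + 1 - (x' μ : ℕ)) + ((x' μ : ℕ) - ((x μ : ℕ) + 1)))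
          at e
        omega
      calc ‖(U x).val - (U x').val‖
          = ‖((U x).val - (U b.tgt).val) + ((U b.tgt).val - (U x').val)‖ := by rw [sub_add_sub_cancel]
        _ ≤ ‖(U x).val - (U b.tgt).val‖ + ‖(U b.tgt).val - (U x').val‖ := norm_add_le _ _
        _ ≤ ε + n * ε := add_le_add (norm_sub_le_of_bond hU b) (ih _ _ (htgt ▸ h'') hx' (htgt ▸ hl1))
        _ = (n + 1 : ℕ) * ε := by push_cast; ring
    · -- step down: `x'' = x − e_μ`, the bond `b = (x'', x)`
      let v : Fin (L * n₁) := ⟨(x μ : ℕ) - 1, by omega⟩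
      let b : Bond L n₁ := ⟨(Function.update x μ v, μ), show ((Function.update x μ v μ : Fin (L * n₁)) : ℕ) + 1 < L * n₁ by
        rw [Function.update_self]; change (x μ : ℕ) - 1 + 1 < _; omega⟩
      have hsrc : b.src = Function.update x μ v := rfl
      have htgt : b.tgt = x := by
        funext ν
        by_cases hν : ν = μ
        · subst hν
          apply Fin.ext
          have h1 : ((b.tgt b.dir : Fin (L * n₁)) : ℕ) = (b.src b.dir : ℕ) + 1 := b.tgt_apply_dir
          change ((b.tgt ν : Fin (L * n₁)) : ℕ) = ((Function.update x ν v ν : Fin (L * n₁)) : ℕ) + 1 at h1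
          rw [h1, Function.update_self]
          change (x ν : ℕ) - 1 + 1 = _
          omega
        · exact (b.tgt_apply_of_ne (by exact hν)).trans (by rw [hsrc, Function.update_of_ne hν])
      have h'' : Function.update x μ v ∈ box L y := by
        rw [mem_box_iff hL]
        intro ν
        by_cases hν : ν = μ
        · subst hν; rw [Function.update_self]; change L * _ ≤ (x ν : ℕ) - 1 ∧ (x ν : ℕ) - 1 < _; omega
        · rw [Function.update_of_ne hν]; exact (mem_box_iff hL).mp hx ν
      have hl1 : l1 (Function.update x μ v) x' = n := by
        have e := l1_update x x' μ v
        change l1 (Function.update x μ v) x' + _ = l1 x x' + (((x μ : ℕ) - 1 - (x' μ : ℕ)) + ((x' μ : ℕ) - ((x μ : ℕ) - 1)))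
          at e
        omega
      calc ‖(U x).val - (U x').val‖
          = ‖((U x).val - (U b.src).val) + ((U b.src).val - (U x').val)‖ := by rw [sub_add_sub_cancel]
        _ ≤ ‖(U x).val - (U b.src).val‖ + ‖(U b.src).val - (U x').val‖ := norm_add_le _ _
        _ ≤ ε + n * ε := by
              refine add_le_add ?_ (ih _ _ (hsrc ▸ h'') hx' (hsrc ▸ hl1))
              rw [← norm_neg, neg_sub]
              have := norm_sub_le_of_bond hU b
              rwa [htgt] at this
        _ = (n + 1 : ℕ) * ε := by push_cast; ring

/-- **Lemma (chain)** (§2.2): *«For `U ∈ Conf_ε(Ω)` and `x, x′ ∈ B(y)` we have `‖U(x)U(x′)* − 1‖ ≤ (2L)ε`.»*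
[cite: DybalskiStottmeisterTanimoto2024, §2.2 Lemma (chain)] -/
theorem chain (hL : 0 < L) {ε : ℝ} (hε : 0 ≤ ε) {U : Conf L n₁} (hU : U ∈ smallField ε) {y : CSite n₁}
    {x x' : Site L n₁} (hx : x ∈ box L y) (hx' : x' ∈ box L y) :
    ‖(U x).val * star (U x').val - 1‖ ≤ 2 * L * ε := by
  rw [norm_mul_star_sub_one]
  calc ‖(U x).val - (U x').val‖ ≤ (l1 x x' : ℕ) * ε := norm_sub_le_l1_mul hL hU _ x x' hx hx' rfl
    _ ≤ (2 * (L - 1) : ℕ) * ε := mul_le_mul_of_nonneg_right (by exact_mod_cast l1_le_of_mem_box hL hx hx') hε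
    _ ≤ 2 * L * ε := by
        apply mul_le_mul_of_nonneg_right _ hε
        have : ((2 * (L - 1) : ℕ) : ℝ) = 2 * ((L : ℝ) - 1) := by
          rw [Nat.cast_mul, Nat.cast_sub hL]; push_cast; ring
        rw [this]; linarith

/-- The chain lemma in the form «`‖U(x) − U(x′)‖ ≤ 2Lε` inside a box» (equivalent by `‖pq* − 1‖ = ‖p − q‖`).
[cite: DybalskiStottmeisterTanimoto2024, §2.2 Lemma (chain)] -/
theorem norm_sub_le_of_mem_box (hL : 0 < L) {ε : ℝ} (hε : 0 ≤ ε) {U : Conf L n₁} (hU : U ∈ smallField ε) {y : CSite n₁}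
    {x x' : Site L n₁} (hx : x ∈ box L y) (hx' : x' ∈ box L y) : ‖(U x).val - (U x').val‖ ≤ 2 * L * ε := by
  rw [← norm_mul_star_sub_one]; exact chain hL hε hU hx hx'

/-! ## Lemma: `|𝒞₀(U)(y)|` is strictly positive for `0 < ε ≤ 1/(4L)` -/

/-- `𝒞₀*𝒞₀ = L⁻⁴ Σ_{x,x′∈B(y)} U(x)*U(x′)` (first line of (N-computation)). [cite: DybalskiStottmeisterTanimoto2024, §2.2 Lemma (N), display (N-computation)] -/
theorem star_C0_mul_C0_eq_sum (U : Conf L n₁) (y : CSite n₁) :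
    star (C0 U y) * C0 U y = ((L : ℝ) ^ 4)⁻¹ • ∑ x ∈ box L y, ∑ x' ∈ box L y, star (U x).val * (U x').val := by
  have hstar : star (C0 U y) = ((L : ℝ) ^ 2)⁻¹ • ∑ x ∈ box L y, star (U x).val := by
    unfold C0
    rw [← Quaternion.coe_mul_eq_smul, star_mul, Quaternion.star_coe, star_sum, ← Quaternion.coe_commutes,
      Quaternion.coe_mul_eq_smul]
  rw [hstar]
  unfold C0
  rw [smul_mul_smul_comm, Finset.sum_mul_sum, ← mul_inv, ← pow_add]

/-- **The display (N-computation)**: `𝒞₀(U)(y)*𝒞₀(U)(y) = 1 + L⁻⁴ Σ_{x≠x′∈B(y)} (U(x)*U(x′) − 1)` (for `L ≥ 1`).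
[cite: DybalskiStottmeisterTanimoto2024, §2.2 Lemma (N), display (N-computation)] -/
theorem N_computation (hL : 0 < L) (U : Conf L n₁) (y : CSite n₁) :
    star (C0 U y) * C0 U y =
      1 + ((L : ℝ) ^ 4)⁻¹ • ∑ x ∈ box L y, ∑ x' ∈ (box L y).erase x, (star (U x).val * (U x').val - 1) := by
  rw [star_C0_mul_C0_eq_sum]
  have hL' : (L : ℝ) ≠ 0 := by exact_mod_cast hL.ne'
  -- per `x`: `Σ_{x'} U(x)*U(x') = 1 + Σ_{x'≠x} (U(x)*U(x') − 1) + (L² − 1)`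
  have inner : ∀ x ∈ box L y, ∑ x' ∈ box L y, star (U x).val * (U x').val =
      ∑ x' ∈ (box L y).erase x, (star (U x).val * (U x').val - 1) + (L : ℝ) ^ 2 • (1 : ℍ) := by
    intro x hx
    rw [Finset.sum_sub_distrib, Finset.sum_const, Finset.card_erase_of_mem hx, card_box,
      ← Finset.add_sum_erase (box L y) (fun x' => star (U x).val * (U x').val) hx, (U x).star_val_mul_val]
    have : (L ^ 2 - 1 : ℕ) • (1 : ℍ) = (L : ℝ) ^ 2 • (1 : ℍ) - 1 := by
      rw [← Nat.cast_smul_eq_nsmul ℝ, Nat.cast_sub (Nat.one_le_pow _ _ hL)]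
      push_cast
      rw [sub_smul, one_smul]
    rw [this]
    abel
  rw [Finset.sum_congr rfl inner, Finset.sum_add_distrib, Finset.sum_const, card_box, smul_add, ← Nat.cast_smul_eq_nsmul ℝ,
    smul_smul, smul_smul]
  have : ((L : ℝ) ^ 4)⁻¹ * ((L ^ 2 : ℕ) : ℝ) * (L : ℝ) ^ 2 = 1 := by
    push_cast
    rw [mul_assoc, ← pow_add, inv_mul_cancel₀ (pow_ne_zero _ hL')]
  rw [this, one_smul, add_comm]

/-- `|‖𝒞₀(U)(y)‖² − 1| ≤ 2Lε` for `U ∈ Conf_ε(Ω)`: the norm form of (N-computation) + Lemma (chain)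
(print: `𝒞₀*𝒞₀ = 1 + O(2Lε)`). [cite: DybalskiStottmeisterTanimoto2024, §2.2 Lemma (N), proof] -/
theorem abs_normSq_C0_sub_one_le (hL : 0 < L) {ε : ℝ} (hε : 0 ≤ ε) {U : Conf L n₁} (hU : U ∈ smallField ε)
    (y : CSite n₁) : |‖C0 U y‖ ^ 2 - 1| ≤ 2 * L * ε := by
  have h1 : ((‖C0 U y‖ ^ 2 - 1 : ℝ) : ℍ) = star (C0 U y) * C0 U y - 1 := by
    rw [star_C0_mul_C0]; push_cast; rfl
  have h2 : |‖C0 U y‖ ^ 2 - 1| = ‖star (C0 U y) * C0 U y - 1‖ := by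
    rw [← h1, Quaternion.norm_coe, Real.norm_eq_abs]
  rw [h2, N_computation hL, add_sub_cancel_left, norm_smul, norm_inv, norm_pow, Real.norm_natCast]
  have hLr : (0 : ℝ) < L := by exact_mod_cast hL
  -- each of the `L²(L² − 1)` terms is `≤ 2Lε`
  have hterm : ∀ x ∈ box L y, ∀ x' ∈ (box L y).erase x, ‖star (U x).val * (U x').val - 1‖ ≤ 2 * L * ε := by
    intro x hx x' hx'
    rw [norm_star_mul_sub_one, ← norm_neg, neg_sub]
    exact norm_sub_le_of_mem_box hL hε hU hx (Finset.mem_of_mem_erase hx')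
  calc ((L : ℝ) ^ 4)⁻¹ * ‖∑ x ∈ box L y, ∑ x' ∈ (box L y).erase x, (star (U x).val * (U x').val - 1)‖
      ≤ ((L : ℝ) ^ 4)⁻¹ * ∑ x ∈ box L y, ∑ x' ∈ (box L y).erase x, 2 * L * ε := by
        refine mul_le_mul_of_nonneg_left ?_ (by positivity)
        refine (norm_sum_le _ _).trans (Finset.sum_le_sum fun x hx => ?_)
        exact (norm_sum_le _ _).trans (Finset.sum_le_sum fun x' hx' => hterm x hx x' hx')
    _ = ((L : ℝ) ^ 4)⁻¹ * ((L : ℝ) ^ 2 * (((L : ℝ) ^ 2 - 1) * (2 * L * ε))) := by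
        congr 1
        rw [Finset.sum_congr rfl fun x hx => by rw [Finset.sum_const, Finset.card_erase_of_mem hx, card_box],
          Finset.sum_const, card_box, nsmul_eq_mul, nsmul_eq_mul, Nat.cast_sub (Nat.one_le_pow _ _ hL)]
        push_cast; ring
    _ = (1 - ((L : ℝ) ^ 2)⁻¹) * (2 * L * ε) := by
        field_simp
    _ ≤ 1 * (2 * L * ε) := by
        have h2 : 0 ≤ 2 * L * ε := by positivity
        have h3 : 0 ≤ ((L : ℝ) ^ 2)⁻¹ := by positivity
        exact mul_le_mul_of_nonneg_right (by linarith) h2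
    _ = 2 * L * ε := one_mul _

/-- **Lemma** (§2.2): *«Let `U ∈ Conf_ε(Ω)`, `0 < ε ≤ 1/(4L)`. Then `|𝒞₀(U)(y)|`, `y ∈ Ω₁`, are strictly positive.»*
(here: `‖𝒞₀(U)(y)‖² ≥ 1/2`, in particular `𝒞₀(U)(y) ≠ 0`). [cite: DybalskiStottmeisterTanimoto2024, §2.2 Lemma (N)] -/
theorem half_le_normSq_C0 (hL : 0 < L) {ε : ℝ} (hε : 0 ≤ ε) (hεL : ε ≤ 1 / (4 * L)) {U : Conf L n₁}
    (hU : U ∈ smallField ε) (y : CSite n₁) : 1 / 2 ≤ ‖C0 U y‖ ^ 2 := by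
  have h := abs_normSq_C0_sub_one_le hL hε hU y
  have hLr : (0 : ℝ) < L := by exact_mod_cast hL
  have h2 : 2 * L * ε ≤ 1 / 2 := by
    calc 2 * L * ε ≤ 2 * L * (1 / (4 * L)) := by gcongr
      _ = 1 / 2 := by field_simp; ring
  rw [abs_le] at h
  linarith

/-- `𝒞₀(U)(y) ≠ 0` in the regime `0 ≤ ε ≤ 1/(4L)`. [cite: DybalskiStottmeisterTanimoto2024, §2.2 Lemma (N)] -/
theorem C0_ne_zero (hL : 0 < L) {ε : ℝ} (hε : 0 ≤ ε) (hεL : ε ≤ 1 / (4 * L)) {U : Conf L n₁}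
    (hU : U ∈ smallField ε) (y : CSite n₁) : C0 U y ≠ 0 := by
  intro h
  have := half_le_normSq_C0 hL hε hεL hU y
  rw [h, norm_zero] at this
  norm_num at this

/-! ## App. B Lemma (square-root), scalar form, with print's constant `c_{1/2}` -/

/-- Print's numerical constant `c_{1/2} ≥ 1` of Lemma (square-root): the value `π√2/(√2+1) ≈ 1.84` of the integral
`∫₀^∞ √y/((y+1)(y+½)) dy` by which it is defined there. [cite: DybalskiStottmeisterTanimoto2024, App. B Lemma (square-root)] -/
def ch : ℝ := Real.pi * Real.sqrt 2 / (Real.sqrt 2 + 1)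

/-- «`c_{1/2} ≥ 1`». [cite: DybalskiStottmeisterTanimoto2024, App. B Lemma (square-root)] -/
theorem one_le_ch : 1 ≤ ch := by
  unfold ch
  have h2 : 1 ≤ Real.sqrt 2 := by
    rw [show (1 : ℝ) = Real.sqrt 1 by rw [Real.sqrt_one]]
    exact Real.sqrt_le_sqrt (by norm_num)
  have hπ := Real.pi_gt_three
  rw [le_div_iff₀ (by linarith)]
  nlinarith

/-- [cite: DybalskiStottmeisterTanimoto2024, App. B Lemma (square-root)] -/
theorem ch_pos : 0 < ch := lt_of_lt_of_le one_pos one_le_ch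

/-- Lemma (square-root), scalar `(1+M)^{1/2}` form: `|√t − 1| ≤ c_{1/2}|t − 1|` for `|t − 1| ≤ 1/2`.
[cite: DybalskiStottmeisterTanimoto2024, App. B Lemma (square-root)] -/
theorem abs_sqrt_sub_one_le {t : ℝ} (ht : |t - 1| ≤ 1 / 2) : |Real.sqrt t - 1| ≤ ch * |t - 1| := by
  have ht0 : 0 ≤ t := by rw [abs_le] at ht; linarith
  have hs0 : 0 ≤ Real.sqrt t := Real.sqrt_nonneg t
  have key : |Real.sqrt t - 1| ≤ |t - 1| := by
    have e : t - 1 = (Real.sqrt t - 1) * (Real.sqrt t + 1) := by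
      have := Real.mul_self_sqrt ht0; ring_nf; nlinarith
    rw [e, abs_mul]
    have h1 : 1 ≤ |Real.sqrt t + 1| := by rw [abs_of_nonneg (by linarith)]; linarith
    nlinarith [abs_nonneg (Real.sqrt t - 1)]
  calc |Real.sqrt t - 1| ≤ |t - 1| := key
    _ = 1 * |t - 1| := (one_mul _).symm
    _ ≤ ch * |t - 1| := mul_le_mul_of_nonneg_right one_le_ch (abs_nonneg _)

/-- Lemma (square-root) as the text applies it, to `(𝒞₀*𝒞₀)^{−1/2}`: `|1/√t − 1| ≤ c_{1/2}|t − 1|` for `|t − 1| ≤ 1/2`.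
[cite: DybalskiStottmeisterTanimoto2024, App. B Lemma (square-root); §2.2 Lemma (configurations), proof] -/
theorem abs_inv_sqrt_sub_one_le {t : ℝ} (ht : |t - 1| ≤ 1 / 2) : |(Real.sqrt t)⁻¹ - 1| ≤ ch * |t - 1| := by
  have ht' := ht
  rw [abs_le] at ht'
  have ht0 : 1 / 2 ≤ t := by linarith
  have hs : Real.sqrt (1 / 2) ≤ Real.sqrt t := Real.sqrt_le_sqrt ht0
  have hhalf : 7 / 10 ≤ Real.sqrt (1 / 2) := (Real.le_sqrt (by norm_num) (by norm_num)).mpr (by norm_num)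
  have hspos : 0 < Real.sqrt t := by linarith
  have e : (Real.sqrt t)⁻¹ - 1 = -(Real.sqrt t - 1) / Real.sqrt t := by
    field_simp
    ring
  have key : |(Real.sqrt t)⁻¹ - 1| ≤ |t - 1| := by
    rw [e, abs_div, abs_neg, abs_of_pos hspos, div_le_iff₀ hspos]
    have e2 : t - 1 = (Real.sqrt t - 1) * (Real.sqrt t + 1) := by
      have := Real.mul_self_sqrt (show 0 ≤ t by linarith); ring_nf; nlinarith
    rw [e2, abs_mul, abs_of_pos (show 0 < Real.sqrt t + 1 by linarith)]
    have : 1 ≤ (Real.sqrt t + 1) * Real.sqrt t := by nlinarith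
    nlinarith [abs_nonneg (Real.sqrt t - 1)]
  calc |(Real.sqrt t)⁻¹ - 1| ≤ |t - 1| := key
    _ = 1 * |t - 1| := (one_mul _).symm
    _ ≤ ch * |t - 1| := mul_le_mul_of_nonneg_right one_le_ch (abs_nonneg _)

/-! ## §2.1 (constraint-simpl): the constraint in the variables `U′(x) = U(x)V(y_x)⁻¹` -/

/-- The change of variables `U(x) = U′(x)V(y_x)`, i.e. `U′(x) := U(x)V(y_x)⁻¹`. [cite: DybalskiStottmeisterTanimoto2024, §2.1 (U(x) = U′(x)V(y_x))] -/
def Uprime (U : Conf L n₁) (V : CConf n₁) : Conf L n₁ := fun x => U x * (V (blk x))⁻¹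

/-- [cite: DybalskiStottmeisterTanimoto2024, §2.1 (U(x) = U′(x)V(y_x))] -/
theorem Uprime_mul (U : Conf L n₁) (V : CConf n₁) (x : Site L n₁) : Uprime U V x * V (blk x) = U x := by
  simp [Uprime, mul_assoc]

/-- `𝒞₀` only sees the block: `𝒞₀(U)(y) = 𝒞₀(U′)(y)·V(y)`. [cite: DybalskiStottmeisterTanimoto2024, §2.1 (constraint-simpl), «we made use of (symmetry-constraint)»] -/
theorem C0_eq_C0_Uprime_mul (U : Conf L n₁) (V : CConf n₁) (y : CSite n₁) :
    C0 U y = C0 (Uprime U V) y * (V y).val := by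
  unfold C0 Uprime
  rw [smul_mul_assoc, Finset.sum_mul]
  congr 1
  refine Finset.sum_congr rfl fun x hx => ?_
  rw [mem_box.mp hx]
  simp [mul_assoc, SU2.star_val_mul_val]

/-- [cite: DybalskiStottmeisterTanimoto2024, §2.1 (constraint-simpl)] -/
theorem norm_C0_Uprime (U : Conf L n₁) (V : CConf n₁) (y : CSite n₁) : ‖C0 (Uprime U V) y‖ = ‖C0 U y‖ := by
  rw [C0_eq_C0_Uprime_mul U V y, norm_mul, (V y).norm_val, mul_one]

/-- Within a block `U′(x)U′(x′)* = U(x)U(x′)*`: the small-field defects of `U′` inside boxes are those of `U`.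
[cite: DybalskiStottmeisterTanimoto2024, §2.2 Lemma (configurations), proof («by Lemma (chain)»)] -/
theorem Uprime_mul_star_Uprime {U : Conf L n₁} {V : CConf n₁} {y : CSite n₁} {x x' : Site L n₁} (hx : x ∈ box L y)
    (hx' : x' ∈ box L y) : (Uprime U V x).val * star (Uprime U V x').val = (U x).val * star (U x').val := by
  unfold Uprime
  rw [mem_box.mp hx, mem_box.mp hx']
  simp only [SU2.mul_val, SU2.inv_val, star_mul, star_star]
  rw [mul_assoc, ← mul_assoc (star (V y).val), SU2.star_val_mul_val, one_mul]

/-- **(2.1)** «`𝒞(U) = V ⇔ 𝒞₀(U′)(y) = (𝒞₀(U′)(y)*𝒞₀(U′)(y))^{1/2}`», blockwise, in the regime `𝒞₀ ≠ 0` where the polar part is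
determined (the right-hand side says: `𝒞₀(U′)(y)` is the non-negative real scalar `|𝒞₀(U′)(y)| = ‖𝒞₀(U′)(y)‖`; «equivalent to
`Re 𝒞₀(U′) ≥ 0` and `Im 𝒞₀(U′) = 0`»). [cite: DybalskiStottmeisterTanimoto2024, §2.1 (constraint-simpl)/(constraint-simpl-x)] -/
theorem constraint_iff_C0_real {U : Conf L n₁} {V : CConf n₁} {y : CSite n₁} (h0 : C0 U y ≠ 0) :
    avg U y = V y ↔ C0 (Uprime U V) y = ((‖C0 (Uprime U V) y‖ : ℝ) : ℍ) := by
  rw [norm_C0_Uprime]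
  set c : ℝ := ‖C0 U y‖ with hc
  have hn : c ≠ 0 := norm_ne_zero_iff.mpr h0
  have hdec : C0 U y = (avg U y).val * (c : ℍ) := C0_eq_avg_mul U y
  have hV := C0_eq_C0_Uprime_mul U V y
  -- `C0 U' = C0 U · V(y)* = avg · c · V(y)*`
  have hU' : C0 (Uprime U V) y = (avg U y).val * (c : ℍ) * star (V y).val := by
    rw [← hdec, hV, mul_assoc, (V y).val_mul_star_val, mul_one]
  rw [hU']
  constructor
  · intro h
    rw [h, ← Quaternion.coe_commutes, mul_assoc, (V y).val_mul_star_val, mul_one]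
  · intro h
    apply SU2.ext
    -- cancel the unit `V(y)*` and the non-zero real scalar `c`
    have h2 : (avg U y).val * (c : ℍ) = (V y).val * (c : ℍ) := by
      have h3 := congrArg (fun q : ℍ => q * (V y).val) h
      simp only [mul_assoc, SU2.star_val_mul_val, mul_one] at h3
      rw [h3, ← Quaternion.coe_commutes]
    have hc0 : (c : ℍ) ≠ 0 := fun h0' => hn (by simpa using congrArg QuaternionAlgebra.re h0')
    exact mul_right_cancel₀ hc0 h2

/-! ## Lemma (configurations): `‖U′(x) − 1‖ ≤ 4c_{1/2}Lε` -/

/-- **Lemma (configurations)** (§2.2): *«Let `0 < ε ≤ 1/(4L)` and suppose that `U ∈ Conf_ε(Ω)` satisfies the constraint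
`𝒞(U) = V`. Then `‖U′(x) − 1‖ ≤ 4c_{1/2}Lε`»* (`U′(x) = U(x)V(y_x)⁻¹`).  Proof as printed: `|‖𝒞₀(U′)‖ − 1| ≤ c_{1/2}(2L)ε`
(Lemma (square-root) on (N-computation)), `L⁻²Σ_{x′∈B(y)}U′(x′) = (1 + (1 − L⁻²)O(2Lε))U′(x)` (Lemma (chain)), and the
constraint `𝒞₀(U′)(y) = ‖𝒞₀(U′)(y)‖`. [cite: DybalskiStottmeisterTanimoto2024, §2.2 Lemma (configurations)] -/
theorem configurations (hL : 0 < L) {ε : ℝ} (hε : 0 < ε) (hεL : ε ≤ 1 / (4 * L)) {U : Conf L n₁}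
    (hU : U ∈ smallField ε) {V : CConf n₁} (hC : avg U = V) (x : Site L n₁) :
    ‖(Uprime U V x).val - 1‖ ≤ 4 * ch * L * ε := by
  set y := blk x with hy
  have hx : x ∈ box L y := mem_box_blk x
  have h0 : C0 U y ≠ 0 := C0_ne_zero hL hε.le hεL hU y
  have hreal : C0 (Uprime U V) y = ((‖C0 (Uprime U V) y‖ : ℝ) : ℍ) :=
    (constraint_iff_C0_real h0).mp (congrFun hC y)
  set ρ := ‖C0 (Uprime U V) y‖ with hρ
  -- (a) `|ρ − 1| ≤ 2 c_{1/2} L ε`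
  have hρ1 : |ρ - 1| ≤ ch * (2 * L * ε) := by
    have h1 : |ρ ^ 2 - 1| ≤ 2 * L * ε := by
      rw [hρ, norm_C0_Uprime]; exact abs_normSq_C0_sub_one_le hL hε.le hU y
    have hLr : (0 : ℝ) < L := by exact_mod_cast hL
    have h2 : 2 * L * ε ≤ 1 / 2 := by
      calc 2 * L * ε ≤ 2 * L * (1 / (4 * L)) := by gcongr
        _ = 1 / 2 := by field_simp; ring
    have h3 : |ρ ^ 2 - 1| ≤ 1 / 2 := h1.trans h2
    have h4 := abs_sqrt_sub_one_le h3
    rw [Real.sqrt_sq (norm_nonneg _)] at h4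
    exact h4.trans (mul_le_mul_of_nonneg_left h1 ch_pos.le)
  -- (b) `ρ = L⁻² Σ_{x'} U'(x') = U'(x) + L⁻² Σ_{x'} (U'(x') − U'(x))`
  have hsum : ((ρ : ℝ) : ℍ) - (Uprime U V x).val =
      ((L : ℝ) ^ 2)⁻¹ • ∑ x' ∈ box L y, ((Uprime U V x').val - (Uprime U V x).val) := by
    rw [← hreal, Finset.sum_sub_distrib, Finset.sum_const, card_box, smul_sub, ← Nat.cast_smul_eq_nsmul ℝ, smul_smul]
    have : ((L : ℝ) ^ 2)⁻¹ * ((L ^ 2 : ℕ) : ℝ) = 1 := by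
      push_cast; exact inv_mul_cancel₀ (by positivity)
    rw [this, one_smul]
    rfl
  have hb : ‖((ρ : ℝ) : ℍ) - (Uprime U V x).val‖ ≤ 2 * L * ε := by
    rw [hsum, norm_smul, norm_inv, norm_pow, Real.norm_natCast]
    have hLr : (0 : ℝ) < L := by exact_mod_cast hL
    have hU' : ∀ x' ∈ box L y, ‖(Uprime U V x').val - (Uprime U V x).val‖ ≤ 2 * L * ε := by
      intro x' hx'
      rw [← norm_mul_star_sub_one, Uprime_mul_star_Uprime hx' hx]
      exact chain hL hε.le hU hx' hx
    calc ((L : ℝ) ^ 2)⁻¹ * ‖∑ x' ∈ box L y, ((Uprime U V x').val - (Uprime U V x).val)‖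
        ≤ ((L : ℝ) ^ 2)⁻¹ * ∑ x' ∈ box L y, 2 * L * ε := by
          refine mul_le_mul_of_nonneg_left ((norm_sum_le _ _).trans (Finset.sum_le_sum hU')) (by positivity)
      _ = 2 * L * ε := by
          rw [Finset.sum_const, card_box, nsmul_eq_mul]; push_cast; field_simp
  -- (c) combine: `‖U'(x) − 1‖ ≤ ‖U'(x) − ρ‖ + |ρ − 1| ≤ 2Lε + 2c_{1/2}Lε ≤ 4c_{1/2}Lε`
  calc ‖(Uprime U V x).val - 1‖
      = ‖((Uprime U V x).val - ((ρ : ℝ) : ℍ)) + (((ρ : ℝ) : ℍ) - 1)‖ := by rw [sub_add_sub_cancel]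
    _ ≤ ‖(Uprime U V x).val - ((ρ : ℝ) : ℍ)‖ + ‖((ρ : ℝ) : ℍ) - 1‖ := norm_add_le _ _
    _ ≤ 2 * L * ε + ch * (2 * L * ε) := by
        refine add_le_add ?_ ?_
        · rw [← norm_neg, neg_sub]; exact hb
        · rw [← Quaternion.coe_one, ← Quaternion.coe_sub, Quaternion.norm_coe, Real.norm_eq_abs]; exact hρ1
    _ ≤ 4 * ch * L * ε := by
        have hLε : 0 ≤ L * ε := by positivity
        nlinarith [one_le_ch]

/-! ## Lemma (A-theorem) and Theorem (configurations-theorem) -/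

/-- The display of the proof of Lemma (A-theorem): for `Re U′ ≥ 0` (`δ = 1`),
`‖U′ − 1‖² = 2|A⃗|²/(1 + √(1 − |A⃗|²))` («`= 2 − 2cos a = 2sin²a/(1 + √(1 − sin²a))`»).
[cite: DybalskiStottmeisterTanimoto2024, §2.2 Lemma (A-theorem), proof] -/
theorem norm_sub_one_sq_eq (q : SU2) (hq : 0 ≤ q.val.re) :
    ‖q.val - 1‖ ^ 2 = 2 * ‖vecOf q.val‖ ^ 2 / (1 + Real.sqrt (1 - ‖vecOf q.val‖ ^ 2)) := by
  rw [norm_val_sub_one_sq, norm_vecOf, SU2.norm_im_sq, sub_sub_cancel, Real.sqrt_sq hq]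
  have : 1 + q.val.re ≠ 0 := by linarith
  field_simp
  ring

/-- **Lemma (A-theorem)** (§2.2): *«Let `0 < ε ≤ 1`. Then `U′ ∈ Conf^ε(Ω) ⇒ (A⃗ ∈ Conf⃗^ε(Ω) and δ = 1)`»*, sitewise:
`‖q − 1‖ ≤ ε ≤ 1` gives `Re q > 0` (`δ = 1`) and `|A⃗| ≤ ‖q − 1‖ ≤ ε`. [cite: DybalskiStottmeisterTanimoto2024, §2.2 Lemma (A-theorem)] -/
theorem A_theorem_site {ε : ℝ} (hε1 : ε ≤ 1) (q : SU2) (hq : ‖q.val - 1‖ ≤ ε) :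
    ‖vecOf q.val‖ ≤ ε ∧ sgn q = 1 := by
  have hε0 : 0 ≤ ε := (norm_nonneg _).trans hq
  have hsq : ‖q.val - 1‖ ^ 2 ≤ 1 := by
    calc ‖q.val - 1‖ ^ 2 ≤ ε ^ 2 := by gcongr
      _ ≤ 1 := by nlinarith
  have hre : 1 / 2 ≤ q.val.re := by rw [norm_val_sub_one_sq] at hsq; linarith
  refine ⟨?_, ?_⟩
  · -- `|A⃗|² ≤ 2|A⃗|²/(1+√(1−|A⃗|²)) = ‖q − 1‖²` since `√(1−|A⃗|²) ≤ 1`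
    have hA := norm_vecOf_le_one q
    have hs : Real.sqrt (1 - ‖vecOf q.val‖ ^ 2) ≤ 1 :=
      (Real.sqrt_le_sqrt (by nlinarith [norm_nonneg (vecOf q.val)])).trans_eq Real.sqrt_one
    have hs0 : 0 ≤ Real.sqrt (1 - ‖vecOf q.val‖ ^ 2) := Real.sqrt_nonneg _
    have key : ‖vecOf q.val‖ ^ 2 ≤ ‖q.val - 1‖ ^ 2 := by
      rw [norm_sub_one_sq_eq q (by linarith), le_div_iff₀ (by linarith)]
      nlinarith [norm_nonneg (vecOf q.val)]
    calc ‖vecOf q.val‖ ≤ ‖q.val - 1‖ := le_of_pow_le_pow_left₀ two_ne_zero (norm_nonneg _) key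
      _ ≤ ε := hq
  · unfold sgn; exact sign_eq_one_iff.mpr (by linarith)

/-- **Lemma (A-theorem)** (§2.2) for configurations: *«Let `0 < ε ≤ 1`. Then `U′ ∈ Conf^ε(Ω) ⇒ (A⃗ ∈ Conf⃗^ε(Ω) and δ = 1)`.»*
[cite: DybalskiStottmeisterTanimoto2024, §2.2 Lemma (A-theorem)] -/
theorem A_theorem {ε : ℝ} (hε1 : ε ≤ 1) {U' : Conf L n₁} (hU' : U' ∈ nearOne ε) :
    (fun x => vecOf (U' x).val) ∈ vecConf ε ∧ ∀ x, sgn (U' x) = 1 :=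
  ⟨fun x => (A_theorem_site hε1 (U' x) (hU' x)).1, fun x => (A_theorem_site hε1 (U' x) (hU' x)).2⟩

/-- **Theorem (configurations-theorem)**, first implication (first-implication-zero): *«`U ∈ Conf_ε(Ω)` and `𝒞(U) = V ⇒
U′ ∈ Conf^{4c_{1/2}Lε}(Ω)`»* («follows from Lemma (configurations)», whose hypothesis `0 < ε ≤ 1/(4L)` is carried).
[cite: DybalskiStottmeisterTanimoto2024, §2.2 Theorem (configurations-theorem), (first-implication-zero)] -/
theorem configurations_theorem_first (hL : 0 < L) {ε : ℝ} (hε : 0 < ε) (hεL : ε ≤ 1 / (4 * L)) {U : Conf L n₁}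
    (hU : U ∈ smallField ε) {V : CConf n₁} (hC : avg U = V) : Uprime U V ∈ nearOne (4 * ch * L * ε) :=
  fun x => configurations hL hε hεL hU hC x

/-- **Theorem (configurations-theorem)**, second implication (first-implication): *«`U′ ∈ Conf^{4c_{1/2}Lε}(Ω) ⇒
(A⃗ ∈ Conf⃗^{4c_{1/2}Lε}(Ω) and s = 1)`. The second implication requires `4c_{1/2}Lε ≤ 1`»* («follows from Lemma (A-theorem)»).
[cite: DybalskiStottmeisterTanimoto2024, §2.2 Theorem (configurations-theorem), (first-implication)] -/
theorem configurations_theorem_second {ε : ℝ} (h1 : 4 * ch * L * ε ≤ 1) {U' : Conf L n₁}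
    (hU' : U' ∈ nearOne (4 * ch * L * ε)) :
    (fun x => vecOf (U' x).val) ∈ vecConf (4 * ch * L * ε) ∧ ∀ x, sgn (U' x) = 1 :=
  A_theorem h1 hU'

/-- The two implications chained, as used from §3 on («Recall that for `U ∈ Conf_ε(Ω)`, `𝒞(U) = V`, we have `|A⃗(x)| ≤ 4c_{1/2}Lε`
… Thus `A₀(x) ≠ 0`», §3.2): in the regime `4c_{1/2}Lε ≤ 1` a constrained small-field configuration has `|A⃗(x)| ≤ 4c_{1/2}Lε` and
`δ = 1` at every site. [cite: DybalskiStottmeisterTanimoto2024, §2.2 Theorem (configurations-theorem); §3.2 (recall)] -/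
theorem vecOf_Uprime_small (hL : 0 < L) {ε : ℝ} (hε : 0 < ε) (h1 : 4 * ch * L * ε ≤ 1) {U : Conf L n₁}
    (hU : U ∈ smallField ε) {V : CConf n₁} (hC : avg U = V) (x : Site L n₁) :
    ‖vecOf (Uprime U V x).val‖ ≤ 4 * ch * L * ε ∧ sgn (Uprime U V x) = 1 := by
  have hLr : (0 : ℝ) < L := by exact_mod_cast hL
  have hεL : ε ≤ 1 / (4 * L) := by
    rw [le_div_iff₀ (by positivity)]
    calc ε * (4 * L) = 1 * (4 * L * ε) := by ring
      _ ≤ ch * (4 * L * ε) := mul_le_mul_of_nonneg_right one_le_ch (by positivity)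
      _ = 4 * ch * L * ε := by ring
      _ ≤ 1 := h1
  have h := configurations_theorem_second h1 (configurations_theorem_first hL hε hεL hU hC)
  exact ⟨h.1 x, h.2 x⟩

end

end Literature.MathematicalPhysics.QuantumFieldTheory.DybalskiStottmeisterTanimoto2024.DST24Configurations
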